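import Summits.HodgeConjecture.HodgeConjecture.Theses.HeckePrymWeil
import Summits.HodgeConjecture.HodgeConjecture.Theorems.HeckePrymWeilWeilSixfoldsSqrtMinus7BaseChangeSplitting
import Summits.HodgeConjecture.HodgeConjecture.Theorems.HeckePrymWeilWeilSixfoldsSqrtMinus7Untwisting
import Summits.HodgeConjecture.HodgeConjecture.Theorems.HeckePrymWeilWeilSixfoldsSqrtMinus7OneClassSuffices
import HarnessLib

/-!
# Route HeckePrymWeil · crux `WeilSixfoldsSqrtMinus7` (stmt-HodgeConjecture-1260) · line
# `real-quadratic-base-change` — THE COMPOSITION: the crux from the open stub `SplitSecantClass` alone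

Lead c2 (`prover-line-stmt-HodgeConjecture-1260-c2-0`), 2026-08-16. With the provable stubs of the
line LANDED — `stub_untwisting` (S1), `baseChangeSplitting` (planner STUB 2 = S2a `stub_splittingArithmetic`
+ S2b `stub_baseChangeModel` + S2c `stub_splitFrameTransport` + line 1's G3/G4′), `stub_oneClassSuffices`
(S4), all in namespace `…Theorems.WeilSixfoldsSqrtMinus7.RealQuadraticBaseChange` — the crux
`WeilSixfoldsSqrtMinus7` (Hodge–Weil classes algebraic on EVERY `ℚ(√-7)`-Weil abelian sixfold, every
discriminant) follows from the ONE open statement C⁺(F) = `SplitSecantClass`: "on every polarized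
abelian 12-fold `(B, ψ_K, ψ_F, h)` with commuting `ψ_K² = -7`, `ψ_F² = t` (`t > 0` non-square), `h`
the `L`-symmetrised hyperplane class of a projective embedding with a rational `a ≠ 0`, of SPLIT
`L`-Weil type, ONE non-zero rational class of the `L`-Weil span is algebraic" — Markman's relative
secant programme (arXiv:2509.23079 Thm 1.1.2, Prop 1.1.1, Lemma 8.3.4, Def 8.3.5, Lemma 10.2.3) at
`(d, e, n) = (6, 4, 6)`; open in print (the `(6,4)` secant pair and the `e = 4` equivariant
semiregularity are unbuilt). This is the second, independent kernel-checked reduction of the crux (the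
first being `weilSixfoldsSqrtMinus7_of_hyperbolicEightfoldsSqrtMinus7`, line `hyperbolic-eightfold-descent`).

No definition, no named fact; the hypothesis is the registered stub `stub_splitSecantClass` of the
skeleton `Lines/real_quadratic_base_change.lean`, verbatim (the theorem is the registered composition
sub-goal `weilSixfoldsSqrtMinus7_of_splitSecantClass`).
-/

noncomputable section

-- single-problem summit (Problem = Summit): the mandated namespace repeats `HodgeConjecture`.
set_option linter.dupNamespace false

open CategoryTheory
open Literature.AlgebraicGeometry.Motives
open Literature.AlgebraicGeometry.HodgeTheory
open Literature.AlgebraicGeometry.Motives.AbelianVariety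
open Literature.AlgebraicTopology.SingularHomology
open Literature.Geometry.Kaehler

namespace Summit.HodgeConjecture.HodgeConjecture.Theorems.WeilSixfoldsSqrtMinus7.RealQuadraticBaseChange

/-! ### The composition: the crux from C⁺(F) = `SplitSecantClass` alone -/

/-- **`WeilSixfoldsSqrtMinus7` from the split secant class** (registered composition stub
`weilSixfoldsSqrtMinus7_of_splitSecantClass` of crux stmt-HodgeConjecture-1260): given `(A, φ)` and a
rational `(3,3)` class `c` of the Weil plane — if `c = 0` it is algebraic; otherwise `c` witnesses
Weil type, `baseChangeSplitting` gives `(t, e, a)` with `A ⊗ O_{ℚ(√t)}` of split `L`-Weil type, the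
hypothesis (C⁺) ONE non-zero rational algebraic `L`-Weil class on it, `stub_oneClassSuffices` all of
them, and `stub_untwisting` descends to `c`. The hypothesis is VERBATIM the statement of the open stub
`stub_splitSecantClass` (Markman's relative secant programme at `(d,e,n) = (6,4,6)`, arXiv:2509.23079
Thm 1.1.2 / Prop 1.1.1 / §1.1). [cite: Markman2025SecantRealMultiplication, Thm. 1.1.2 and Lemma 8.3.4 (2)]
[cite: vanGeemen1994HodgeAV, Lemma 5.2 and Thm. 6.12] -/
theorem weilSixfoldsSqrtMinus7_of_splitSecantClass :
    (∀ (B : AbelianVariety ℂ) (ψK ψF : B ⟶ B) (t : ℕ), B.dim = 12 → ψK ≫ ψK = -((7 : ℤ) • 𝟙 B) →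
      ψF ≫ ψF = (t : ℤ) • 𝟙 B → ψK ≫ ψF = ψF ≫ ψK → 0 < t → ¬ IsSquare t →
      ∀ (e : ProjectiveEmbedding B.X) (a : complexBetti (projectiveSpace e.n ℂ) 2),
        IsRationalClass a → a ≠ 0 →
        (∃ u : Fin 12 → complexBetti B.X 1,
          (∀ i, IsRationalClass (u i)) ∧ LinearIndependent ℂ u ∧
          (∀ i, complexBetti.map ψK.hom.hom.hom 1 (u i) ∈ Submodule.span ℂ (Set.range u)) ∧
          (∀ i, complexBetti.map ψF.hom.hom.hom 1 (u i) ∈ Submodule.span ℂ (Set.range u)) ∧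
          ∀ i j, polarizationPairingOne B.X
              ((7 : ℂ) • (((t : ℂ) • complexBetti.map e.ι 2 a +
                  complexBetti.map ψF.hom.hom.hom 2 (complexBetti.map e.ι 2 a))) +
                complexBetti.map ψK.hom.hom.hom 2
                  ((t : ℂ) • complexBetti.map e.ι 2 a + complexBetti.map ψF.hom.hom.hom 2 (complexBetti.map e.ι 2 a)))
              11 (u i) (u j) = 0) →
        ∃ c₀ : complexBetti B.X 6, IsRationalClass c₀ ∧
          c₀ ∈ ((Module.End.eigenspace (complexBetti.map (𝟙 B + ψK).hom.hom.hom 6).hom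
                    ((1 + Complex.I * (Real.sqrt (7 : ℝ) : ℂ)) ^ 6) ⊓
                  Module.End.eigenspace (complexBetti.map (𝟙 B + ψF).hom.hom.hom 6).hom
                    ((1 + (Real.sqrt (t : ℝ) : ℂ)) ^ 6)) ⊔
                (Module.End.eigenspace (complexBetti.map (𝟙 B + ψK).hom.hom.hom 6).hom
                    ((1 + Complex.I * (Real.sqrt (7 : ℝ) : ℂ)) ^ 6) ⊓
                  Module.End.eigenspace (complexBetti.map (𝟙 B + ψF).hom.hom.hom 6).hom
                    ((1 - (Real.sqrt (t : ℝ) : ℂ)) ^ 6))) ⊔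
               ((Module.End.eigenspace (complexBetti.map (𝟙 B + ψK).hom.hom.hom 6).hom
                    ((1 - Complex.I * (Real.sqrt (7 : ℝ) : ℂ)) ^ 6) ⊓
                  Module.End.eigenspace (complexBetti.map (𝟙 B + ψF).hom.hom.hom 6).hom
                    ((1 + (Real.sqrt (t : ℝ) : ℂ)) ^ 6)) ⊔
                (Module.End.eigenspace (complexBetti.map (𝟙 B + ψK).hom.hom.hom 6).hom
                    ((1 - Complex.I * (Real.sqrt (7 : ℝ) : ℂ)) ^ 6) ⊓
                  Module.End.eigenspace (complexBetti.map (𝟙 B + ψF).hom.hom.hom 6).hom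
                    ((1 - (Real.sqrt (t : ℝ) : ℂ)) ^ 6))) ∧
          c₀ ≠ 0 ∧ c₀ ∈ algebraicClasses B.X 3) →
    Summit.HodgeConjecture.HodgeConjecture.Theses.HeckePrymWeil.WeilSixfoldsSqrtMinus7 := by
  intro h3 A φ hdim hφ c hrat hhodge hmem
  by_cases hc : c = 0
  · rw [hc]
    exact Submodule.zero_mem _
  · obtain ⟨t, e, a, ht, hsq, ha, ha0, hsplit⟩ :=
      baseChangeSplitting A φ hdim hφ ⟨c, hrat, hhodge, hmem, hc⟩
    have hone := h3 (A.prod A) _ _ t (dim_prod_self_eq_twelve hdim) (psiK_comp_psiK hφ)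
      (psiF_comp_psiF A t) (psiK_comm_psiF A φ t) ht hsq e a ha ha0 hsplit
    have hL := stub_oneClassSuffices (A.prod A) _ _ t (dim_prod_self_eq_twelve hdim) (psiK_comp_psiK hφ)
      (psiF_comp_psiF A t) (psiK_comm_psiF A φ t) ht hsq hone
    exact stub_untwisting A φ hdim hφ t ht hL c hrat hhodge hmem

end Summit.HodgeConjecture.HodgeConjecture.Theorems.WeilSixfoldsSqrtMinus7.RealQuadraticBaseChange

end
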